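import Mathlib
import HarnessLib
import Summits.HubbardSuperconductivity.HubbardSuperconductivity.Theorems.KLProgrammeKLRegimeWickScaleFlowC1
import Summits.HubbardSuperconductivity.HubbardSuperconductivity.Theorems.KLProgrammeKLRegimeEnginePairLadderFlowStep

/-!
# Route `KLProgramme` — crux K3, ENGINE child gen 5 (stmt-HubbardSuperconductivity-19918 `KLRegimeEngineV14`), stub `stub_engine_step_values`,
# conjunct (E2-v9) at `1 ≤ n`: the Wick pair-ladder step OF THE MODEL from the within-slice flow — `klws_wickStep_of_scaleFlow_grid`

Cell gate-hubbard-kl, seat hubbard-kl-k3c1-p1 (g6), technique «composed-map remainder propagation».  Third file of the model-level bridge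
(`…WickScaleFlow` p504230: `∂_Λ K_Λ = −½·𝒱₄(e^{Δ_{D_Λ}}(δ𝒱_Λ/δψ, Ċ_Λ δ𝒱_Λ/δψ))`; `…WickScaleFlowC1`: that derivative is continuous in `Λ`).
Here the slice `[Λ₁, Λ₀]` (`0 < Λ₁ ≤ Λ₀`; on the grid `Λ₀ = Λ_{n−1}`, `Λ₁ = Λ_n`) is traversed by the affine path `Λ(t) = Λ₀ + t(Λ₁ − Λ₀)`,
`t ∈ [0,1]`, and the flow data of `kltc_riccati_duhamel_weighted` (p500198) / `kltc_wickStep_of_flow` (p501252) are DISCHARGED for the model: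

* `klws_pairKernelR_flowData` — with `Γ t := K_{Λ(t)}(Q)` (the frequency-resolved Wick pair kernel at real cutoff, a matrix on
  `TorusSite 2 L × MatsubaraIdx M`) and `Γ̇ t := (Λ₁ − Λ₀)•(−½·𝒱₄(e^{Δ_{D_{Λ(t)}}}(δ𝒱/δψ, Ċ_{Λ(t)} δ𝒱/δψ))(pair labels))`:
  `hΓ` (entrywise `HasDerivAt` on `[0,1]`) and `hΓ'c` (entrywise `ContinuousOn [0,1]`), given only `Z^K_Λ ≠ 0` on the slice.
* **`klws_wickStep_of_scaleFlow`** — `kltc_wickStep_of_flow` INSTANTIATED on these data: for any base array `C` on the momentum carrier, rung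
  functions `b, ḃ` with the rate/tail/smallness hypotheses, an a priori entry bound `|K_{Λ(t)}| ≤ m` along the slice, and the source
  `X := Γ̇ + Γ·diag ḃ·Γ` (so `∫|X|` is what the channel reading / ph turnkeys must bound): `∃ N` two-sided inverse of `1 + diag(Σ_ν(b(1)−b(0)))·C`
  with `‖K_{Λ₁}(Q)(x,y) − (C·N)(x.1,y.1)‖ ≤ FT_ρ(∫₀¹|X|)(x,y) + [‖K_{Λ₀}(Q) − C^ext‖ four-term](x,y)`.
* **`klws_wickStep_of_scaleFlow_grid`** — the same on the grid slice `[Λ_n, Λ_{n−1}]`, `1 ≤ n`, concluding about p1 g9's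
  `klWickPairKernel … n Q` from `klWickPairKernel … (n−1) Q`: the (W-a)_n relation in the input format of `kltc_tower_compose_fwd` (p496062).

Exact calculus + the landed analysis; the remaining inputs (`b`, `ḃ`, `ρ`, the a priori bound, the `∫|X|` budget) are hypotheses; nothing about
superconductivity is asserted.  0 kit.
-/

noncomputable section

namespace Summit.HubbardSuperconductivity.HubbardSuperconductivity.Theorems.KLRegimeWick

set_option linter.dupNamespace false -- summit = problem name (single-conjunct summit), D-0017

open Finset Matrix Set Literature.MathematicalPhysics.QuantumLattice GrassmannAlgebra
open Literature.Probability.LatticeModels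
open Summit.HubbardSuperconductivity.HubbardSuperconductivity.Theorems.KLProgrammeLegKernels
open Summit.HubbardSuperconductivity.HubbardSuperconductivity.Theorems.KLRegimeSplit
open scoped Topology

section Model

variable (L M : ℕ) [NeZero L] (β U μ : ℝ) (K : TrigPolyC4v)

/-! ## §1 The affine scale path and the flow data of the real-cutoff pair kernel -/

omit [NeZero L] in
/-- The affine path `Λ(t) = Λ₀ + t(Λ₁ − Λ₀)` stays in the slice `[Λ₁, Λ₀]` for `t ∈ [0,1]`. -/
theorem klws_affine_mem_Icc {Λ₀ Λ₁ : ℝ} (h10 : Λ₁ ≤ Λ₀) {t : ℝ} (ht : t ∈ Icc (0 : ℝ) 1) :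
    Λ₀ + t * (Λ₁ - Λ₀) ∈ Icc Λ₁ Λ₀ := by
  constructor <;> nlinarith [ht.1, ht.2]

omit [NeZero L] in
/-- `Λ̇(t) = Λ₁ − Λ₀`. -/
theorem klws_hasDerivAt_affine (Λ₀ Λ₁ t : ℝ) : HasDerivAt (fun s : ℝ => Λ₀ + s * (Λ₁ - Λ₀)) (Λ₁ - Λ₀) t := by
  simpa using ((hasDerivAt_id t).mul_const (Λ₁ - Λ₀)).const_add Λ₀

/-- **Flow data of the real-cutoff Wick pair kernel along the slice** `[Λ₁, Λ₀]`, `0 < Λ₁ ≤ Λ₀`, `Z^K ≠ 0` on the slice: with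
`Γ t := K_{Λ(t)}(Q)` and `Γ̇ t := (Λ₁ − Λ₀)•(−½·𝒱₄(e^{Δ_{D_{Λ(t)}}}(δ𝒱_{Λ(t)}/δψ, Ċ_{Λ(t)} δ𝒱_{Λ(t)}/δψ))(pair labels))` (given by
equations, pass `rfl`): entrywise `HasDerivAt` on `[0,1]` (`hΓ`) and entrywise continuity of `Γ̇` on `[0,1]` (`hΓ'c`). -/
theorem klws_pairKernelR_flowData {Λ₀ Λ₁ : ℝ} (h10 : Λ₁ ≤ Λ₀) (h1 : 0 < Λ₁)
    (hZ : ∀ Λ ∈ Icc Λ₁ Λ₀, hubbardEffPartitionFnCT L M β U μ 0 K Λ ≠ 0) (Q : TorusSite 2 L)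
    (Γ Γ' : ℝ → Matrix (TorusSite 2 L × MatsubaraIdx M) (TorusSite 2 L × MatsubaraIdx M) ℂ)
    (hΓdef : Γ = fun t => Matrix.of fun x y => vertexFn L M β
      (gaussConv ℂ (hubbardCovBelowCT L M β μ 0 K (Λ₀ + t * (Λ₁ - Λ₀)))
        (hubbardEffectiveActionCT L M β U μ 0 K (Λ₀ + t * (Λ₁ - Λ₀)))) 4
      ![(((y.2, y.1), 0), 0), (((y.2.rev, Q - y.1), 1), 0), (((x.2.rev, Q - x.1), 1), 1), (((x.2, x.1), 0), 1)])
    (hΓ'def : Γ' = fun t => Matrix.of fun x y => (Λ₁ - Λ₀) • -((2 : ℂ)⁻¹ * vertexFn L M β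
      (gaussConv ℂ (hubbardCovBelowCT L M β μ 0 K (Λ₀ + t * (Λ₁ - Λ₀)))
        (grassmannDerivPairing ℂ
          (Matrix.of fun X Y : HubbardFieldIdx L M =>
            deriv (fun Λ'' : ℝ => hubbardCovAboveCT L M β μ 0 K Λ'' X Y) (Λ₀ + t * (Λ₁ - Λ₀)))
          (hubbardEffectiveActionCT L M β U μ 0 K (Λ₀ + t * (Λ₁ - Λ₀)))
          (hubbardEffectiveActionCT L M β U μ 0 K (Λ₀ + t * (Λ₁ - Λ₀))))) 4
      ![(((y.2, y.1), 0), 0), (((y.2.rev, Q - y.1), 1), 0), (((x.2.rev, Q - x.1), 1), 1), (((x.2, x.1), 0), 1)])) :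
    (∀ t ∈ Icc (0 : ℝ) 1, ∀ x y, HasDerivAt (fun s => Γ s x y) (Γ' t x y) t) ∧
      ∀ x y, ContinuousOn (fun t => Γ' t x y) (Icc 0 1) := by
  have hne : ∀ t ∈ Icc (0 : ℝ) 1, Λ₀ + t * (Λ₁ - Λ₀) ≠ 0 := fun t ht =>
    (h1.trans_le (klws_affine_mem_Icc h10 ht).1).ne'
  have hZt : ∀ t ∈ Icc (0 : ℝ) 1, hubbardEffPartitionFnCT L M β U μ 0 K (Λ₀ + t * (Λ₁ - Λ₀)) ≠ 0 := fun t ht =>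
    hZ _ (klws_affine_mem_Icc h10 ht)
  subst hΓdef hΓ'def
  refine ⟨fun t ht x y => ?_, fun x y t ht => ?_⟩
  · have hg := klws_hasDerivAt_pairKernelR L M β U μ K (klws_hasDerivAt_hardCov_scale L M β μ K (hne t ht)) (hZt t ht) Q x y
    have h := hg.scomp t (klws_hasDerivAt_affine Λ₀ Λ₁ t)
    simpa only [Matrix.of_apply, Function.comp_def] using h
  · have hc := klws_continuousAt_pairKernelR_deriv_scale L M β U μ K (hne t ht) (hZt t ht) Q x y
    have h := (ContinuousAt.comp (f := fun s : ℝ => Λ₀ + s * (Λ₁ - Λ₀)) (x := t) hc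
      (klws_hasDerivAt_affine Λ₀ Λ₁ t).continuousAt).const_smul (Λ₁ - Λ₀)
    simpa only [Matrix.of_apply, Function.comp_def, Pi.smul_def] using h.continuousWithinAt

/-! ## §2 The Wick pair-ladder step of the model from the flow -/

/-- **The Wick pair-ladder step of the MODEL from the within-slice flow** (`kltc_wickStep_of_flow` on the data of
`klws_pairKernelR_flowData`).  Slice `[Λ₁, Λ₀]`, `0 < Λ₁ ≤ Λ₀`, `Z^K ≠ 0` on it; `Γ, Γ̇` as there (pass `rfl, rfl`); rung functions `b, ḃ` on
the product carrier with `HasDerivAt`, continuous `ḃ`, rate `Σ‖ḃ‖ ≤ βr`, tails `‖b(1) − b(t)‖ ≤ ρ`, `(3/2)m·Σρ ≤ 1/3`; an a priori bound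
`|K_{Λ(t)}| ≤ m` along the slice; a base array `C` on momenta with `|C| ≤ m₀`, `m₀·Σρ ≤ 1/3`; the source `X t := Γ̇ t + Γ t·diag(ḃ t)·Γ t`.
THEN `∃ N` two-sided inverse of `1 + diag(Σ_ν (b 1 − b 0)(·,ν))·C`, `|C·N| ≤ (3/2)m₀`, and for all `x y`,
`‖K_{Λ₁}(Q)(x,y) − (C·N)(x.1,y.1)‖ ≤ FT_ρ(∫₀¹|X|)(x,y) + [‖K_{Λ₀}(Q) − C^ext‖ four-term weighted by |b 1 − b 0|](x,y)`. -/
theorem klws_wickStep_of_scaleFlow [NeZero M] {Λ₀ Λ₁ : ℝ} (h10 : Λ₁ ≤ Λ₀) (h1 : 0 < Λ₁)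
    (hZ : ∀ Λ ∈ Icc Λ₁ Λ₀, hubbardEffPartitionFnCT L M β U μ 0 K Λ ≠ 0) (Q : TorusSite 2 L)
    (Γ Γ' X : ℝ → Matrix (TorusSite 2 L × MatsubaraIdx M) (TorusSite 2 L × MatsubaraIdx M) ℂ)
    (hΓdef : Γ = fun t => Matrix.of fun x y => vertexFn L M β
      (gaussConv ℂ (hubbardCovBelowCT L M β μ 0 K (Λ₀ + t * (Λ₁ - Λ₀)))
        (hubbardEffectiveActionCT L M β U μ 0 K (Λ₀ + t * (Λ₁ - Λ₀)))) 4
      ![(((y.2, y.1), 0), 0), (((y.2.rev, Q - y.1), 1), 0), (((x.2.rev, Q - x.1), 1), 1), (((x.2, x.1), 0), 1)])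
    (hΓ'def : Γ' = fun t => Matrix.of fun x y => (Λ₁ - Λ₀) • -((2 : ℂ)⁻¹ * vertexFn L M β
      (gaussConv ℂ (hubbardCovBelowCT L M β μ 0 K (Λ₀ + t * (Λ₁ - Λ₀)))
        (grassmannDerivPairing ℂ
          (Matrix.of fun X Y : HubbardFieldIdx L M =>
            deriv (fun Λ'' : ℝ => hubbardCovAboveCT L M β μ 0 K Λ'' X Y) (Λ₀ + t * (Λ₁ - Λ₀)))
          (hubbardEffectiveActionCT L M β U μ 0 K (Λ₀ + t * (Λ₁ - Λ₀)))
          (hubbardEffectiveActionCT L M β U μ 0 K (Λ₀ + t * (Λ₁ - Λ₀))))) 4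
      ![(((y.2, y.1), 0), 0), (((y.2.rev, Q - y.1), 1), 0), (((x.2.rev, Q - x.1), 1), 1), (((x.2, x.1), 0), 1)]))
    (C : Matrix (TorusSite 2 L) (TorusSite 2 L) ℂ) (b b' : ℝ → TorusSite 2 L × MatsubaraIdx M → ℂ)
    (ρ : TorusSite 2 L × MatsubaraIdx M → ℝ) {m m₀ βr : ℝ} (hm : 0 ≤ m) (hm₀ : 0 ≤ m₀) (hC : ∀ s t, ‖C s t‖ ≤ m₀)
    (hb : ∀ t ∈ Icc (0 : ℝ) 1, ∀ a, HasDerivAt (fun s => b s a) (b' t a) t)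
    (hb'c : ∀ a, ContinuousOn (fun t => b' t a) (Icc 0 1))
    (hX : ∀ t ∈ Icc (0 : ℝ) 1, X t = Γ' t + Γ t * diagonal (b' t) * Γ t)
    (hΓm : ∀ t ∈ Icc (0 : ℝ) 1, ∀ x y, ‖Γ t x y‖ ≤ m) (hβ : ∀ t ∈ Icc (0 : ℝ) 1, ∑ a, ‖b' t a‖ ≤ βr)
    (hρ : ∀ t ∈ Icc (0 : ℝ) 1, ∀ a, ‖b 1 a - b t a‖ ≤ ρ a) (hsm : 3 / 2 * m * ∑ a, ρ a ≤ 1 / 3) (hsm₀ : m₀ * ∑ a, ρ a ≤ 1 / 3) :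
    ∃ N : Matrix (TorusSite 2 L) (TorusSite 2 L) ℂ,
      (1 + diagonal (fun s => ∑ c : MatsubaraIdx M, (b 1 - b 0) (s, c)) * C) * N = 1 ∧
      N * (1 + diagonal (fun s => ∑ c : MatsubaraIdx M, (b 1 - b 0) (s, c)) * C) = 1 ∧ (∀ s t, ‖(C * N) s t‖ ≤ 3 / 2 * m₀) ∧
      ∀ x y : TorusSite 2 L × MatsubaraIdx M,
        ‖vertexFn L M β (gaussConv ℂ (hubbardCovBelowCT L M β μ 0 K Λ₁) (hubbardEffectiveActionCT L M β U μ 0 K Λ₁)) 4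
            ![(((y.2, y.1), 0), 0), (((y.2.rev, Q - y.1), 1), 0), (((x.2.rev, Q - x.1), 1), 1), (((x.2, x.1), 0), 1)] -
          (C * N) x.1 y.1‖ ≤
        ((∫ t in (0 : ℝ)..1, ‖X t x y‖) + 3 / 2 * (3 / 2 * m) * ∑ c, (∫ t in (0 : ℝ)..1, ‖X t x c‖) * ρ c +
          3 / 2 * m * ∑ a, ρ a * (∫ t in (0 : ℝ)..1, ‖X t a y‖) +
            9 / 4 * m * (3 / 2 * m) * ∑ a, ∑ c, ρ a * (∫ t in (0 : ℝ)..1, ‖X t a c‖) * ρ c) +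
        (‖Γ 0 x y - C x.1 y.1‖ + 3 / 2 * m₀ * ∑ c, ‖Γ 0 x c - C x.1 c.1‖ * ‖(b 1 - b 0) c‖ +
          3 / 2 * m * ∑ a, ‖(b 1 - b 0) a‖ * ‖Γ 0 a y - C a.1 y.1‖ +
            9 / 4 * m * m₀ * ∑ a, ∑ c, ‖(b 1 - b 0) a‖ * ‖Γ 0 a c - C a.1 c.1‖ * ‖(b 1 - b 0) c‖) := by
  obtain ⟨hΓ, hΓ'c⟩ := klws_pairKernelR_flowData L M β U μ K h10 h1 hZ Q Γ Γ' hΓdef hΓ'def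
  obtain ⟨N, hN1, hN2, hCN, hstep⟩ :=
    kltc_wickStep_of_flow C Γ Γ' X b b' ρ hm hm₀ hC hΓ hb hΓ'c hb'c hX hΓm hβ hρ hsm hsm₀
  refine ⟨N, hN1, hN2, hCN, fun x y => ?_⟩
  have h1 : Γ 1 x y = vertexFn L M β (gaussConv ℂ (hubbardCovBelowCT L M β μ 0 K Λ₁)
      (hubbardEffectiveActionCT L M β U μ 0 K Λ₁)) 4
      ![(((y.2, y.1), 0), 0), (((y.2.rev, Q - y.1), 1), 0), (((x.2.rev, Q - x.1), 1), 1), (((x.2, x.1), 0), 1)] := by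
    subst hΓdef
    simp only [Matrix.of_apply, one_mul, add_sub_cancel]
  rw [← h1]
  exact hstep x y

/-- The scale grid is positive and decreasing: `0 < Λ_n ≤ Λ_{n−1}`. -/
theorem klws_klScale_pos_antitone (n : ℕ) : 0 < klScale klE0 n ∧ klScale klE0 n ≤ klScale klE0 (n - 1) := by
  refine ⟨by unfold klScale klE0; positivity, ?_⟩
  unfold klScale
  have he : (0 : ℝ) ≤ klE0 := by unfold klE0; norm_num
  refine mul_le_mul_of_nonneg_left ?_ he
  exact inv_anti₀ (by positivity) (pow_le_pow_right₀ (by norm_num) (Nat.sub_le n 1))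

/-- **The Wick pair-ladder step (W-a)_n of the model on the grid slice `[Λ_n, Λ_{n−1}]`** (`1 ≤ n`), concluding about
`klWickPairKernel … n Q` from `klWickPairKernel … (n−1) Q`: hypotheses as in `klws_wickStep_of_scaleFlow` with `Λ₀ = Λ_{n−1}`, `Λ₁ = Λ_n`;
conclusion `‖K_n(Q)(x,y) − (C·N)(x.1,y.1)‖ ≤ FT_ρ(∫₀¹|X|)(x,y) + [‖K_{n−1}(Q) − C^ext‖ four-term](x,y)` — the input format of
`kltc_tower_compose_fwd` / `pairLadderStepAtV9_of_wickTower_fwd`. -/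
theorem klws_wickStep_of_scaleFlow_grid [NeZero M] (n : ℕ)
    (hZ : ∀ Λ ∈ Icc (klScale klE0 n) (klScale klE0 (n - 1)), hubbardEffPartitionFnCT L M β U μ 0 K Λ ≠ 0) (Q : TorusSite 2 L)
    (Γ Γ' X : ℝ → Matrix (TorusSite 2 L × MatsubaraIdx M) (TorusSite 2 L × MatsubaraIdx M) ℂ)
    (hΓdef : Γ = fun t => Matrix.of fun x y => vertexFn L M β
      (gaussConv ℂ (hubbardCovBelowCT L M β μ 0 K (klScale klE0 (n - 1) + t * (klScale klE0 n - klScale klE0 (n - 1))))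
        (hubbardEffectiveActionCT L M β U μ 0 K (klScale klE0 (n - 1) + t * (klScale klE0 n - klScale klE0 (n - 1))))) 4
      ![(((y.2, y.1), 0), 0), (((y.2.rev, Q - y.1), 1), 0), (((x.2.rev, Q - x.1), 1), 1), (((x.2, x.1), 0), 1)])
    (hΓ'def : Γ' = fun t => Matrix.of fun x y => (klScale klE0 n - klScale klE0 (n - 1)) • -((2 : ℂ)⁻¹ * vertexFn L M β
      (gaussConv ℂ (hubbardCovBelowCT L M β μ 0 K (klScale klE0 (n - 1) + t * (klScale klE0 n - klScale klE0 (n - 1))))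
        (grassmannDerivPairing ℂ
          (Matrix.of fun X Y : HubbardFieldIdx L M =>
            deriv (fun Λ'' : ℝ => hubbardCovAboveCT L M β μ 0 K Λ'' X Y)
              (klScale klE0 (n - 1) + t * (klScale klE0 n - klScale klE0 (n - 1))))
          (hubbardEffectiveActionCT L M β U μ 0 K (klScale klE0 (n - 1) + t * (klScale klE0 n - klScale klE0 (n - 1))))
          (hubbardEffectiveActionCT L M β U μ 0 K (klScale klE0 (n - 1) + t * (klScale klE0 n - klScale klE0 (n - 1)))))) 4
      ![(((y.2, y.1), 0), 0), (((y.2.rev, Q - y.1), 1), 0), (((x.2.rev, Q - x.1), 1), 1), (((x.2, x.1), 0), 1)]))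
    (C : Matrix (TorusSite 2 L) (TorusSite 2 L) ℂ) (b b' : ℝ → TorusSite 2 L × MatsubaraIdx M → ℂ)
    (ρ : TorusSite 2 L × MatsubaraIdx M → ℝ) {m m₀ βr : ℝ} (hm : 0 ≤ m) (hm₀ : 0 ≤ m₀) (hC : ∀ s t, ‖C s t‖ ≤ m₀)
    (hb : ∀ t ∈ Icc (0 : ℝ) 1, ∀ a, HasDerivAt (fun s => b s a) (b' t a) t)
    (hb'c : ∀ a, ContinuousOn (fun t => b' t a) (Icc 0 1))
    (hX : ∀ t ∈ Icc (0 : ℝ) 1, X t = Γ' t + Γ t * diagonal (b' t) * Γ t)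
    (hΓm : ∀ t ∈ Icc (0 : ℝ) 1, ∀ x y, ‖Γ t x y‖ ≤ m) (hβ : ∀ t ∈ Icc (0 : ℝ) 1, ∑ a, ‖b' t a‖ ≤ βr)
    (hρ : ∀ t ∈ Icc (0 : ℝ) 1, ∀ a, ‖b 1 a - b t a‖ ≤ ρ a) (hsm : 3 / 2 * m * ∑ a, ρ a ≤ 1 / 3) (hsm₀ : m₀ * ∑ a, ρ a ≤ 1 / 3) :
    ∃ N : Matrix (TorusSite 2 L) (TorusSite 2 L) ℂ,
      (1 + diagonal (fun s => ∑ c : MatsubaraIdx M, (b 1 - b 0) (s, c)) * C) * N = 1 ∧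
      N * (1 + diagonal (fun s => ∑ c : MatsubaraIdx M, (b 1 - b 0) (s, c)) * C) = 1 ∧ (∀ s t, ‖(C * N) s t‖ ≤ 3 / 2 * m₀) ∧
      ∀ x y : TorusSite 2 L × MatsubaraIdx M,
        ‖klWickPairKernel L M β U μ K n Q x y - (C * N) x.1 y.1‖ ≤
        ((∫ t in (0 : ℝ)..1, ‖X t x y‖) + 3 / 2 * (3 / 2 * m) * ∑ c, (∫ t in (0 : ℝ)..1, ‖X t x c‖) * ρ c +
          3 / 2 * m * ∑ a, ρ a * (∫ t in (0 : ℝ)..1, ‖X t a y‖) +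
            9 / 4 * m * (3 / 2 * m) * ∑ a, ∑ c, ρ a * (∫ t in (0 : ℝ)..1, ‖X t a c‖) * ρ c) +
        (‖klWickPairKernel L M β U μ K (n - 1) Q x y - C x.1 y.1‖ +
          3 / 2 * m₀ * ∑ c, ‖klWickPairKernel L M β U μ K (n - 1) Q x c - C x.1 c.1‖ * ‖(b 1 - b 0) c‖ +
          3 / 2 * m * ∑ a, ‖(b 1 - b 0) a‖ * ‖klWickPairKernel L M β U μ K (n - 1) Q a y - C a.1 y.1‖ +
            9 / 4 * m * m₀ * ∑ a, ∑ c,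
              ‖(b 1 - b 0) a‖ * ‖klWickPairKernel L M β U μ K (n - 1) Q a c - C a.1 c.1‖ * ‖(b 1 - b 0) c‖) := by
  obtain ⟨hpos, hle⟩ := klws_klScale_pos_antitone n
  obtain ⟨N, hN1, hN2, hCN, hstep⟩ := klws_wickStep_of_scaleFlow L M β U μ K hle hpos hZ Q Γ Γ' X hΓdef hΓ'def C b b' ρ hm hm₀ hC
    hb hb'c hX hΓm hβ hρ hsm hsm₀
  refine ⟨N, hN1, hN2, hCN, fun x y => ?_⟩
  have h0 : ∀ a c : TorusSite 2 L × MatsubaraIdx M, Γ 0 a c = klWickPairKernel L M β U μ K (n - 1) Q a c := fun a c => by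
    subst hΓdef
    simp only [Matrix.of_apply, zero_mul, add_zero]
    exact klws_pairKernelR_klScale L M β U μ K (n - 1) Q a c
  have h := hstep x y
  rw [klws_pairKernelR_klScale] at h
  simp only [h0] at h
  exact h

/-! ## §3 The increment of the Wick pair kernel across the slice (the (E2″)-type clause on the continuous route) -/

/-- **Increment of the real-cutoff pair kernel across a slice** (`kltc_increment_of_flow`, p501875, on the data of `klws_pairKernelR_flowData`):
with `Γ, Γ̇` as in `klws_pairKernelR_flowData` (pass `rfl, rfl`), continuous rungs `ḃ`, an a priori bound `|K_{Λ(t)}| ≤ m` along the slice and the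
source `X := Γ̇ + Γ·diag ḃ·Γ`: `‖K_{Λ₁}(Q)(x,y) − K_{Λ₀}(Q)(x,y)‖ ≤ ∫₀¹‖X t x y‖ + m²·∫₀¹ Σ_c ‖ḃ t c‖` — no resummation, no smallness. -/
theorem klws_increment_of_scaleFlow {Λ₀ Λ₁ : ℝ} (h10 : Λ₁ ≤ Λ₀) (h1 : 0 < Λ₁)
    (hZ : ∀ Λ ∈ Icc Λ₁ Λ₀, hubbardEffPartitionFnCT L M β U μ 0 K Λ ≠ 0) (Q : TorusSite 2 L)
    (Γ Γ' X : ℝ → Matrix (TorusSite 2 L × MatsubaraIdx M) (TorusSite 2 L × MatsubaraIdx M) ℂ)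
    (hΓdef : Γ = fun t => Matrix.of fun x y => vertexFn L M β
      (gaussConv ℂ (hubbardCovBelowCT L M β μ 0 K (Λ₀ + t * (Λ₁ - Λ₀)))
        (hubbardEffectiveActionCT L M β U μ 0 K (Λ₀ + t * (Λ₁ - Λ₀)))) 4
      ![(((y.2, y.1), 0), 0), (((y.2.rev, Q - y.1), 1), 0), (((x.2.rev, Q - x.1), 1), 1), (((x.2, x.1), 0), 1)])
    (hΓ'def : Γ' = fun t => Matrix.of fun x y => (Λ₁ - Λ₀) • -((2 : ℂ)⁻¹ * vertexFn L M β
      (gaussConv ℂ (hubbardCovBelowCT L M β μ 0 K (Λ₀ + t * (Λ₁ - Λ₀)))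
        (grassmannDerivPairing ℂ
          (Matrix.of fun X Y : HubbardFieldIdx L M =>
            deriv (fun Λ'' : ℝ => hubbardCovAboveCT L M β μ 0 K Λ'' X Y) (Λ₀ + t * (Λ₁ - Λ₀)))
          (hubbardEffectiveActionCT L M β U μ 0 K (Λ₀ + t * (Λ₁ - Λ₀)))
          (hubbardEffectiveActionCT L M β U μ 0 K (Λ₀ + t * (Λ₁ - Λ₀))))) 4
      ![(((y.2, y.1), 0), 0), (((y.2.rev, Q - y.1), 1), 0), (((x.2.rev, Q - x.1), 1), 1), (((x.2, x.1), 0), 1)]))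
    (b' : ℝ → TorusSite 2 L × MatsubaraIdx M → ℂ) {m : ℝ} (hm : 0 ≤ m)
    (hb'c : ∀ a, ContinuousOn (fun t => b' t a) (Icc 0 1))
    (hX : ∀ t ∈ Icc (0 : ℝ) 1, X t = Γ' t + Γ t * diagonal (b' t) * Γ t)
    (hΓm : ∀ t ∈ Icc (0 : ℝ) 1, ∀ x y, ‖Γ t x y‖ ≤ m) (x y : TorusSite 2 L × MatsubaraIdx M) :
    ‖vertexFn L M β (gaussConv ℂ (hubbardCovBelowCT L M β μ 0 K Λ₁) (hubbardEffectiveActionCT L M β U μ 0 K Λ₁)) 4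
          ![(((y.2, y.1), 0), 0), (((y.2.rev, Q - y.1), 1), 0), (((x.2.rev, Q - x.1), 1), 1), (((x.2, x.1), 0), 1)] -
        vertexFn L M β (gaussConv ℂ (hubbardCovBelowCT L M β μ 0 K Λ₀) (hubbardEffectiveActionCT L M β U μ 0 K Λ₀)) 4
          ![(((y.2, y.1), 0), 0), (((y.2.rev, Q - y.1), 1), 0), (((x.2.rev, Q - x.1), 1), 1), (((x.2, x.1), 0), 1)]‖ ≤
      (∫ t in (0 : ℝ)..1, ‖X t x y‖) + m ^ 2 * ∫ t in (0 : ℝ)..1, ∑ c, ‖b' t c‖ := by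
  obtain ⟨hΓ, hΓ'c⟩ := klws_pairKernelR_flowData L M β U μ K h10 h1 hZ Q Γ Γ' hΓdef hΓ'def
  have h := kltc_increment_of_flow Γ Γ' X b' hm hΓ hΓ'c hb'c hX hΓm x y
  have h1 : Γ 1 x y = vertexFn L M β (gaussConv ℂ (hubbardCovBelowCT L M β μ 0 K Λ₁)
      (hubbardEffectiveActionCT L M β U μ 0 K Λ₁)) 4
      ![(((y.2, y.1), 0), 0), (((y.2.rev, Q - y.1), 1), 0), (((x.2.rev, Q - x.1), 1), 1), (((x.2, x.1), 0), 1)] := by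
    subst hΓdef
    simp only [Matrix.of_apply, one_mul, add_sub_cancel]
  have h0 : Γ 0 x y = vertexFn L M β (gaussConv ℂ (hubbardCovBelowCT L M β μ 0 K Λ₀)
      (hubbardEffectiveActionCT L M β U μ 0 K Λ₀)) 4
      ![(((y.2, y.1), 0), 0), (((y.2.rev, Q - y.1), 1), 0), (((x.2.rev, Q - x.1), 1), 1), (((x.2, x.1), 0), 1)] := by
    subst hΓdef
    simp only [Matrix.of_apply, zero_mul, add_zero]
  rw [← h1, ← h0]
  exact h

/-- **Increment of p1's `klWickPairKernel` across the grid slice `[Λ_n, Λ_{n−1}]`**: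
`‖K_n(Q)(x,y) − K_{n−1}(Q)(x,y)‖ ≤ ∫₀¹‖X t x y‖ + m²·∫₀¹ Σ_c ‖ḃ t c‖`. -/
theorem klws_increment_of_scaleFlow_grid (n : ℕ)
    (hZ : ∀ Λ ∈ Icc (klScale klE0 n) (klScale klE0 (n - 1)), hubbardEffPartitionFnCT L M β U μ 0 K Λ ≠ 0) (Q : TorusSite 2 L)
    (Γ Γ' X : ℝ → Matrix (TorusSite 2 L × MatsubaraIdx M) (TorusSite 2 L × MatsubaraIdx M) ℂ)
    (hΓdef : Γ = fun t => Matrix.of fun x y => vertexFn L M β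
      (gaussConv ℂ (hubbardCovBelowCT L M β μ 0 K (klScale klE0 (n - 1) + t * (klScale klE0 n - klScale klE0 (n - 1))))
        (hubbardEffectiveActionCT L M β U μ 0 K (klScale klE0 (n - 1) + t * (klScale klE0 n - klScale klE0 (n - 1))))) 4
      ![(((y.2, y.1), 0), 0), (((y.2.rev, Q - y.1), 1), 0), (((x.2.rev, Q - x.1), 1), 1), (((x.2, x.1), 0), 1)])
    (hΓ'def : Γ' = fun t => Matrix.of fun x y => (klScale klE0 n - klScale klE0 (n - 1)) • -((2 : ℂ)⁻¹ * vertexFn L M β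
      (gaussConv ℂ (hubbardCovBelowCT L M β μ 0 K (klScale klE0 (n - 1) + t * (klScale klE0 n - klScale klE0 (n - 1))))
        (grassmannDerivPairing ℂ
          (Matrix.of fun X Y : HubbardFieldIdx L M =>
            deriv (fun Λ'' : ℝ => hubbardCovAboveCT L M β μ 0 K Λ'' X Y)
              (klScale klE0 (n - 1) + t * (klScale klE0 n - klScale klE0 (n - 1))))
          (hubbardEffectiveActionCT L M β U μ 0 K (klScale klE0 (n - 1) + t * (klScale klE0 n - klScale klE0 (n - 1))))
          (hubbardEffectiveActionCT L M β U μ 0 K (klScale klE0 (n - 1) + t * (klScale klE0 n - klScale klE0 (n - 1)))))) 4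
      ![(((y.2, y.1), 0), 0), (((y.2.rev, Q - y.1), 1), 0), (((x.2.rev, Q - x.1), 1), 1), (((x.2, x.1), 0), 1)]))
    (b' : ℝ → TorusSite 2 L × MatsubaraIdx M → ℂ) {m : ℝ} (hm : 0 ≤ m)
    (hb'c : ∀ a, ContinuousOn (fun t => b' t a) (Icc 0 1))
    (hX : ∀ t ∈ Icc (0 : ℝ) 1, X t = Γ' t + Γ t * diagonal (b' t) * Γ t)
    (hΓm : ∀ t ∈ Icc (0 : ℝ) 1, ∀ x y, ‖Γ t x y‖ ≤ m) (x y : TorusSite 2 L × MatsubaraIdx M) :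
    ‖klWickPairKernel L M β U μ K n Q x y - klWickPairKernel L M β U μ K (n - 1) Q x y‖ ≤
      (∫ t in (0 : ℝ)..1, ‖X t x y‖) + m ^ 2 * ∫ t in (0 : ℝ)..1, ∑ c, ‖b' t c‖ := by
  obtain ⟨hpos, hle⟩ := klws_klScale_pos_antitone n
  have h := klws_increment_of_scaleFlow L M β U μ K hle hpos hZ Q Γ Γ' X hΓdef hΓ'def b' hm hb'c hX hΓm x y
  rwa [klws_pairKernelR_klScale, klws_pairKernelR_klScale] at h

end Model

end Summit.HubbardSuperconductivity.HubbardSuperconductivity.Theorems.KLRegimeWick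

end
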